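import Literature.MathematicalPhysics.QuantumFieldTheory.OSContinuationGlue
import Literature.MathematicalPhysics.QuantumFieldTheory.OSLabelledBounds
import Literature.Analysis.Complex.BochnerExplicitBounds
import HarnessLib

/-!
# The continuation step of OS II with spatial labels and uniform constants; all levels; Thm. 4.2

Topic `Literature/MathematicalPhysics/QuantumFieldTheory`; support file (all proved; no new
definitions; no named facts) for the discharge of (A1) `OS1975_exists_timeContinuation`.
Osterwalder–Schrader II (Comm. Math. Phys. 42 (1975)), Ch. V.2 pp. 294–296 with Ch. VI.2: **the
induction (A_N) ⇒ (P_N) ⇒ (A_{N+1}) for OS's own regions, with the spatial variables as labels and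
with growth constants uniform over the labels** (`OSLabelledPieces`, `OSLabelledBounds`,
`OSContinuationGlue`). From labelled level data at `N` (`IsOSLabelledLevel N good S Φ`) with growth
uniform over a class `good` of labels closed under the doubling of the parts
(`IsOSLabelledGrowth`, `IsOSLabelSet`), the semigroup hypotheses (`IsOSSemigroup`) and the labelled
real-point vectors (`IsOSLabelledVectors`):

1. `norm_glue_leL` — the glued function of the step (old function on `c^{(N+1)}`, piece functions
   on the generating set) is bounded by `glueConst · Π^{stepExp}` on the argument region of every
   compact part of `stepBase N k`, for every good label;
2. `IsOSLabelledLevel.succ_uniform` — **the step**: level data at `N + 1` for the same class of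
   labels, extending the given one, with growth `succConst`, `succExp` (vectors by
   `exists_vectors`, pieces by `exists_pieceFunL`, gluing by `exists_glue`, Bochner in polar form
   `exists_holomorphic_extension_argRegion_convexHull` to the region of
   `conv (stepBase N k) = c_k^{(N+2)}`, bounds by the explicit maximum principle
   `norm_le_explicit_of_polyGrowth_argRegion` on the shrunken bases);
3. `IsOSLabelledLevel.exists_level_uniform` — all levels, constants `iterConst`;
4. `IsOSLabelledLevel.exists_continuation_halfPlanes_uniform` — **OS II Thm. 4.2, the analytic
   continuation in all time gaps, for every good label**: `S k c` extends to a function holomorphic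
   on `ℂ₊ᵏ = {Re ζᵢ > 0}` (`⋃_N C_k^{(N)} = ℂ₊ᵏ`, Lemma 5.2), bounded by `cubeConst K · Π^{cubeExp K}`
   on the argument region of every compact part `K` of the cube `(-π/2, π/2)ᵏ` — constants which are
   functions of the input constants and of `K` only (uniform over the labels: the input for joint
   continuity in the spatial variables, OS p. 294).

## References

* K. Osterwalder, R. Schrader, *Axioms for Euclidean Green's functions II*, Comm. Math. Phys. 42
  (1975) 281–305, §IV.2 Thm. 4.2, Ch. V.2 pp. 294–296, Lemma 5.2, Ch. VI.2 (6.15), (6.22), (6.28). [OsterwalderSchraderCMP1975]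
-/

noncomputable section

open Metric Set Filter Complex
open scoped Topology ComplexConjugate InnerProductSpace Pointwise

namespace Literature.MathematicalPhysics.QuantumFieldTheory.OSEnvelope

open Literature.Analysis.Complex Literature.MathematicalPhysics.QuantumFieldTheory

variable {E : Type*} {H : Type*} [NormedAddCommGroup H] [InnerProductSpace ℂ H]

/-! ### The bound for the glued function -/

section Glue

variable [CompleteSpace H] {T : ℂ → H →L[ℂ] H} {CT : ℝ} {N : ℕ}
  {good : (k : ℕ) → (Fin (k + 1) → E) → Prop} {S : (k : ℕ) → (Fin (k + 1) → E) → (Fin k → ℂ) → ℂ}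
  {Cfun : (k : ℕ) → Set (Fin k → ℝ) → ℝ} {pfun : ℕ → ℕ}

omit [CompleteSpace H] in
/-- **The glued function of the labelled step is bounded by `glueConst · Π^{stepExp}`** on the
argument region of every compact part of the base, for every good label. [cite: OsterwalderSchraderCMP1975, Ch. VI.2 (6.22), (6.28)] -/
theorem norm_glue_leL (hT : IsOSSemigroup T CT) (hgood : IsOSLabelSet good)
    (hG : IsOSLabelledGrowth N good S Cfun pfun)
    {Ψ : (m : ℕ) → (Fin (m + 1) → E) → ℝ → (Fin m → ℂ) → H}
    (hnorm : ∀ (m : ℕ) (a : Fin (m + 1) → E), good (m + 1 + m) (dblPos a) → ∀ x : ℝ, 0 < x →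
      ∀ ζ ∈ argRegion (osBaseD (N + 1) m),
      ‖Ψ m a x ζ‖ ^ 2 = (S (m + 1 + m) (dblPos a) (cDiagEmbed (star ζ) ((2 * x : ℝ) : ℂ) ζ)).re)
    {k : ℕ} {c : Fin (k + 1) → E} (hc : good k c) {F : Fin k → (Fin k → ℂ) → ℂ}
    (hF : ∀ (p : Fin k), ∀ Z ∈ argRegion (osPiece (N + 1) k p), ∀ (x' x : ℝ) (τ : ℂ), 0 < x' → 0 < x →
      0 ≤ τ.re → (x' : ℂ) + x + τ = Z p →
        F p Z = ⟪Ψ p (posRevLeft c p) x' (star (blockRevLeft Z p)),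
          T τ (Ψ (k - 1 - p) (posRight c p) x (blockRight Z p))⟫_ℂ)
    {G : (Fin k → ℂ) → ℂ} (hGS : EqOn G (S k c) (argRegion (osBaseC (N + 1) k)))
    (hGF : ∀ p, EqOn G (F p) (argRegion (osPiece (N + 1) k p)))
    {K : Set (Fin k → ℝ)} (hKc : IsCompact K) (hK : K ⊆ stepBase N k)
    {Z : Fin k → ℂ} (hZ : Z ∈ argRegion K) :
    ‖G Z‖ ≤ glueConst N CT Cfun pfun k K * gFactor Z ^ stepExp pfun k := by
  rw [glueConst, dif_pos ⟨hKc, hK⟩]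
  set ex := exists_compact_cover_stepBase N k hKc hK with hex
  set K₀ := ex.choose with hK₀def
  set Kp := ex.choose_spec.choose with hKpdef
  have hspec := ex.choose_spec.choose_spec
  obtain ⟨hK₀c, hK₀, hKpc, hKp, hcov⟩ := hspec
  set θ : Fin k → ℝ := fun p => (exists_abs_apply_le_of_isCompact (hKpc p) (hKp p)).choose with hθ
  have hθspec : ∀ p, 0 ≤ θ p ∧ θ p < Real.pi / 2 ∧ ∀ v ∈ Kp p, |v p| ≤ θ p := fun p =>
    (exists_abs_apply_le_of_isCompact (hKpc p) (hKp p)).choose_spec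
  set C₀ : ℝ := max (Cfun k K₀) 0 with hC₀
  set Cp : Fin k → ℝ := fun p => max (pieceConst CT Cfun pfun k p (Kp p) (Real.cos (θ p))) 0 with hCp
  show ‖G Z‖ ≤ (C₀ + ∑ p, Cp p) * gFactor Z ^ stepExp pfun k
  have hZre := hZ.1
  have hZne : ∀ i, Z i ≠ 0 := fun i h => by have := hZre i; rw [h] at this; simp at this
  have hP0 : 0 ≤ gFactor Z := gFactor_nonneg Z
  have hCp0 : ∀ p, 0 ≤ Cp p := fun p => le_max_right _ _
  have hC₀0 : 0 ≤ C₀ := le_max_right _ _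
  have hsum0 : 0 ≤ ∑ p, Cp p := Finset.sum_nonneg fun p _ => hCp0 p
  rcases hcov hZ.2 with h₀ | hp
  · have hZmem : Z ∈ argRegion (osBaseC (N + 1) k) := ⟨hZre, hK₀ h₀⟩
    rw [hGS hZmem]
    have h := hG.bound k c hc K₀ hK₀ hK₀c Z ⟨hZre, h₀⟩
    calc ‖S k c Z‖ ≤ Cfun k K₀ * gFactor Z ^ pfun k := h
      _ ≤ C₀ * gFactor Z ^ stepExp pfun k := by
          refine le_trans (mul_le_mul_of_nonneg_right (le_max_left (Cfun k K₀) 0) (pow_nonneg hP0 _)) ?_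
          exact mul_le_mul_of_nonneg_left (gFactor_pow_le_pow hZne (le_max_left _ _)) hC₀0
      _ ≤ (C₀ + ∑ p, Cp p) * gFactor Z ^ stepExp pfun k := by
          refine mul_le_mul_of_nonneg_right ?_ (pow_nonneg hP0 _); linarith
  · obtain ⟨p, hpZ⟩ := mem_iUnion.1 hp
    have hZmem : Z ∈ argRegion (osPiece (N + 1) k p) := ⟨hZre, hKp p hpZ⟩
    rw [hGF p hZmem]
    have h := norm_pieceFun_leL hT hgood hG (G := fun m a => good (m + 1 + m) (dblPos a))
      (fun _ _ h => h) hnorm hc (hF p) (hKpc p) (hKp p) (hθspec p).2.1 (hθspec p).2.2 (Z := Z) ⟨hZre, hpZ⟩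
    calc ‖F p Z‖ ≤ pieceConst CT Cfun pfun k p (Kp p) (Real.cos (θ p)) * gFactor Z ^ pieceExp pfun k p := h
      _ ≤ Cp p * gFactor Z ^ stepExp pfun k := by
          refine le_trans (mul_le_mul_of_nonneg_right
            (le_max_left (pieceConst CT Cfun pfun k p (Kp p) (Real.cos (θ p))) 0) (pow_nonneg hP0 _)) ?_
          refine mul_le_mul_of_nonneg_left (gFactor_pow_le_pow hZne ?_) (hCp0 p)
          exact (Finset.le_sup (f := fun p : Fin k => pieceExp pfun k p) (Finset.mem_univ p)).trans
            (le_max_right _ _)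
      _ ≤ (C₀ + ∑ p, Cp p) * gFactor Z ^ stepExp pfun k := by
          refine mul_le_mul_of_nonneg_right ?_ (pow_nonneg hP0 _)
          have : Cp p ≤ ∑ q, Cp q := Finset.single_le_sum (f := Cp) (fun q _ => hCp0 q) (Finset.mem_univ p)
          linarith

end Glue

/-! ### The step with uniform constants -/

section Step

variable [CompleteSpace H] {T : ℂ → H →L[ℂ] H} {CT : ℝ}
  {Φ : (n : ℕ) → (Fin (n + 1) → E) → ℝ → (Fin n → ℝ) → H}
  {N : ℕ} {good : (k : ℕ) → (Fin (k + 1) → E) → Prop} {S : (k : ℕ) → (Fin (k + 1) → E) → (Fin k → ℂ) → ℂ}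
  {Cfun : (k : ℕ) → Set (Fin k → ℝ) → ℝ} {pfun : ℕ → ℕ}

/-- **The labelled induction step (A_N) ⇒ (A_{N+1}) of OS II, Ch. V.2, with explicit, label-uniform
growth constants**: from labelled level data at `N` with growth uniform over a class of labels
closed under the doubling of the parts, level data at `N + 1` for the same class, extending the
given one (for every label, on the old region), with growth
`IsOSLabelledGrowth (N+1) good S' (succConst N CT Cfun pfun) (succExp pfun)`. [cite: OsterwalderSchraderCMP1975, Ch. V.2 pp. 294–296 and Ch. VI.2 (6.28)] -/
theorem IsOSLabelledLevel.succ_uniform (hT : IsOSSemigroup T CT) (hΦ : IsOSLabelledVectors T Φ)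
    (hgood : IsOSLabelSet good) (hL : IsOSLabelledLevel N good S Φ) (hG : IsOSLabelledGrowth N good S Cfun pfun) :
    ∃ S' : (k : ℕ) → (Fin (k + 1) → E) → (Fin k → ℂ) → ℂ,
      IsOSLabelledLevel (N + 1) good S' Φ ∧
      (∀ k c, EqOn (S' k c) (S k c) (argRegion (osBaseC (N + 1) k))) ∧
      IsOSLabelledGrowth (N + 1) good S' (succConst N CT Cfun pfun) (succExp pfun) := by
  classical
  -- (1) the vectors, for the labels with good doubled label
  obtain ⟨Ψ, hΨ⟩ := hL.exists_vectors hΦ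
  have hhol : ∀ (m : ℕ) (a : Fin (m + 1) → E), good (m + 1 + m) (dblPos a) → ∀ x : ℝ, 0 < x →
      DifferentiableOn ℂ (Ψ m a x) (argRegion (osBaseD (N + 1) m)) :=
    fun m a ha x hx => (hΨ m a ha x hx).1
  have hreal : ∀ (m : ℕ) (a : Fin (m + 1) → E), good (m + 1 + m) (dblPos a) → ∀ x : ℝ, 0 < x →
      ∀ η : Fin m → ℝ, (∀ i, 0 < η i) → Ψ m a x (fun i => (η i : ℂ)) = Φ m a x η :=
    fun m a ha x hx => (hΨ m a ha x hx).2.1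
  have hnorm : ∀ (m : ℕ) (a : Fin (m + 1) → E), good (m + 1 + m) (dblPos a) → ∀ x : ℝ, 0 < x →
      ∀ ζ ∈ argRegion (osBaseD (N + 1) m),
      ‖Ψ m a x ζ‖ ^ 2 = (S (m + 1 + m) (dblPos a) (cDiagEmbed (star ζ) ((2 * x : ℝ) : ℂ) ζ)).re :=
    fun m a ha x hx => (hΨ m a ha x hx).2.2.1
  have hshift : ∀ (m : ℕ) (a : Fin (m + 1) → E), good (m + 1 + m) (dblPos a) → ∀ x : ℝ, 0 < x →
      ∀ t : ℝ, 0 < t → ∀ ζ ∈ argRegion (osBaseD (N + 1) m), T t (Ψ m a x ζ) = Ψ m a (x + t) ζ :=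
    fun m a ha x hx => (hΨ m a ha x hx).2.2.2
  -- (2) the piece functions, for the good labels
  have hpieces : ∀ (k : ℕ) (c : Fin (k + 1) → E) (p : Fin k), good k c →
      ∃ F : (Fin k → ℂ) → ℂ, DifferentiableOn ℂ F (argRegion (osPiece (N + 1) k p)) ∧
      ∀ Z ∈ argRegion (osPiece (N + 1) k p), ∀ (x' x : ℝ) (τ : ℂ), 0 < x' → 0 < x → 0 ≤ τ.re →
        (x' : ℂ) + x + τ = Z p →
          F Z = ⟪Ψ p (posRevLeft c p) x' (star (blockRevLeft Z p)),
            T τ (Ψ (k - 1 - p) (posRight c p) x (blockRight Z p))⟫_ℂ :=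
    fun k c p hc => exists_pieceFunL hT (G := fun m a => good (m + 1 + m) (dblPos a)) hhol hshift k c p
      (hgood.left k c p hc) (hgood.right k c p hc)
  choose! F hFd hFsplit using hpieces
  have hFreal : ∀ (k : ℕ) (c : Fin (k + 1) → E) (p : Fin k), good k c → ∀ ρ : Fin k → ℝ, (∀ i, 0 < ρ i) →
      F k c p (fun i => (ρ i : ℂ)) = S k c (fun i => (ρ i : ℂ)) :=
    fun k c p hc ρ hρ => pieceFunL_ofReal hT hL (G := fun m a => good (m + 1 + m) (dblPos a)) hreal
      (hgood.left k c p hc) (hgood.right k c p hc) (hFsplit k c p hc) hρ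
  -- (3) glue, for every `k` and every good label
  have hglue : ∀ (k : ℕ) (c : Fin (k + 1) → E), good k c → ∃ G : (Fin k → ℂ) → ℂ,
      DifferentiableOn ℂ G (argRegion (stepBase N k)) ∧ EqOn G (S k c) (argRegion (osBaseC (N + 1) k)) ∧
      ∀ p, EqOn G (F k c p) (argRegion (osPiece (N + 1) k p)) :=
    fun k c hc => exists_glue (hL.holo k c hc) (fun p => hFd k c p hc) (fun p ρ hρ => hFreal k c p hc ρ hρ)
  choose! Gf hGd hGS hGF using hglue
  -- (4) the bound for the glued functions, with the explicit constant
  have hGgr : ∀ (k : ℕ) (c : Fin (k + 1) → E), good k c → ∀ K ⊆ stepBase N k, IsCompact K → ∀ Z ∈ argRegion K,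
      ‖Gf k c Z‖ ≤ glueConst N CT Cfun pfun k K * gFactor Z ^ stepExp pfun k :=
    fun k c hc K hK hKc Z hZ => norm_glue_leL hT hgood hG hnorm hc (hFsplit k c · hc) (hGS k c hc) (hGF k c hc)
      hKc hK hZ
  -- (5) extend, for every `k` and every label (trivially for the labels outside the class)
  have hext : ∀ (k : ℕ) (c : Fin (k + 1) → E), ∃ S' : (Fin k → ℂ) → ℂ,
      (good k c → DifferentiableOn ℂ S' (argRegion (osBaseC (N + 2) k))) ∧
      EqOn S' (S k c) (argRegion (osBaseC (N + 1) k)) ∧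
      (good k c → EqOn S' (Gf k c) (argRegion (stepBase N k))) := by
    intro k c
    by_cases hc : good k c
    · rcases Nat.eq_zero_or_pos k with rfl | hk
      · refine ⟨S 0 c, fun _ => ?_, fun _ _ => rfl, fun _ Z hZ => ?_⟩
        · rw [show N + 2 = (N + 1) + 1 from rfl, osBaseC_succ_zero, argRegion_empty]
          exact differentiableOn_empty
        · exfalso
          rcases hZ.2 with h | ⟨p, -⟩
          · rw [osBaseC_succ_zero] at h; exact h
          · exact p.elim0
      obtain ⟨fext, hfd, hfeq, -, -⟩ := exists_holomorphic_extension_argRegion_convexHull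
        (isOpen_stepBase N k) (zero_mem_stepBase N hk) (starConvex_stepBase N k) (stepBase_subset_cube N k)
        (hGd k c hc) ⟨stepExp pfun k, fun K hK hKc => ⟨glueConst N CT Cfun pfun k K,
          fun Z hZre hZK => hGgr k c hc K hK hKc Z ⟨hZre, hZK⟩⟩⟩
      rw [convexHull_stepBase] at hfd
      refine ⟨fext, fun _ => hfd, fun Z hZ => ?_, fun _ => hfeq⟩
      have hZ' : Z ∈ argRegion (stepBase N k) := argRegion_mono subset_union_left hZ
      rw [show fext Z = Gf k c Z from hfeq hZ', hGS k c hc hZ]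
    · exact ⟨S k c, fun h => absurd h hc, fun _ _ => rfl, fun h => absurd h hc⟩
  choose S' hS'd hS'eq hS'G using hext
  refine ⟨S', ⟨fun k c hc => hS'd k c hc, fun k c p ρ hρ x' x hx' hx hsum => ?_⟩, hS'eq,
    ⟨fun k c hc K hK hKc Z hZ => ?_⟩⟩
  · have hmem : (fun i => (ρ i : ℂ)) ∈ argRegion (osBaseC (N + 1) k) :=
      ofReal_mem_argRegion (zero_mem_osBaseC _ (Fin.pos p)) hρ
    rw [hS'eq k c hmem]
    exact hL.gram k c p ρ hρ x' x hx' hx hsum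
  · -- (6) the uniform growth of the new level at `(k, c, K)`
    rcases Nat.eq_zero_or_pos k with rfl | hk
    · exfalso
      rw [show N + 2 = (N + 1) + 1 from rfl, osBaseC_succ_zero] at hK
      exact hK hZ.2
    rw [succConst, dif_pos ⟨hKc, hK, hk⟩]
    set ex := exists_lt_one_subset_smul (isOSBaseFamily_osBase.convex (N + 2) k)
      (isOpen_osBaseC_succ (N + 1) k) (zero_mem_osBaseC _ hk) hKc hK with hex
    set t₀ : ℝ := ex.choose with ht₀def
    obtain ⟨ht₀0, ht₀1, hKt⟩ := ex.choose_spec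
    -- the shrunken base
    set B' : Set (Fin k → ℝ) := t₀ • stepBase N k with hB'
    obtain ⟨hB'o, hB'0, hB'st, hB'conv⟩ := smul_stepBase_props N hk ht₀0
    have hB'K : B' ⊆ t₀ • closure (stepBase N k) := smul_set_mono subset_closure
    have hKcl : t₀ • closure (stepBase N k) ⊆ stepBase N k := smul_closure_stepBase_subset N hk ht₀0.le ht₀1
    have hB'cube : B' ⊆ {v | ∀ i, |v i| < Real.pi / 2} :=
      (hB'K.trans hKcl).trans (stepBase_subset_cube N k)
    -- `S' k c` on the region of `conv B' = t₀ · c^{(N+2)} ⊆ c^{(N+2)}`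
    have hconvsub : convexHull ℝ B' ⊆ osBaseC (N + 2) k := by
      rw [hB'conv]
      have h := smul_set_subset_smul_set_of_le (isOSBaseFamily_osBase.convex (N + 2) k)
        (zero_mem_osBaseC _ hk) ht₀0.le ht₀1.le
      rwa [one_smul] at h
    have hfB' : DifferentiableOn ℂ (S' k c) (argRegion (convexHull ℝ B')) :=
      (hS'd k c hc).mono (argRegion_mono hconvsub)
    -- the bound on the region of `B'`
    have hgrB' : ∀ ζ : Fin k → ℂ, (∀ i, 0 < (ζ i).re) → (fun i => (ζ i).arg) ∈ B' →
        ‖S' k c ζ‖ ≤ glueConst N CT Cfun pfun k (t₀ • closure (stepBase N k)) * gFactor ζ ^ stepExp pfun k := by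
      intro ζ hζ hζB'
      have hζst : ζ ∈ argRegion (stepBase N k) := ⟨hζ, hKcl (hB'K hζB')⟩
      rw [hS'G k c hc hζst]
      exact hGgr k c hc _ hKcl (isCompact_smul_closure_stepBase N k t₀) ζ ⟨hζ, hB'K hζB'⟩
    have hZconv : (fun i => (Z i).arg) ∈ convexHull ℝ B' := by rw [hB'conv]; exact hKt hZ.2
    have h := norm_le_explicit_of_polyGrowth_argRegion hB'o hB'0 hB'st hB'cube hfB' hgrB' hZ.1 hZconv
    simpa only [succExp, gFactor, mul_assoc] using h

/-! ### All levels and the continuation, with explicit constants -/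

/-- **All levels with explicit, label-uniform constants.** [cite: OsterwalderSchraderCMP1975, Ch. V.2 pp. 294–296 and Ch. VI.2 (6.28)] -/
theorem IsOSLabelledLevel.exists_level_uniform (hT : IsOSSemigroup T CT) (hΦ : IsOSLabelledVectors T Φ)
    (hgood : IsOSLabelSet good) (hL : IsOSLabelledLevel N good S Φ) (hG : IsOSLabelledGrowth N good S Cfun pfun)
    (n : ℕ) :
    ∃ S' : (k : ℕ) → (Fin (k + 1) → E) → (Fin k → ℂ) → ℂ,
      IsOSLabelledLevel (N + n) good S' Φ ∧ (∀ k c, EqOn (S' k c) (S k c) (argRegion (osBaseC (N + 1) k))) ∧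
      IsOSLabelledGrowth (N + n) good S' (iterConst N CT Cfun pfun n).1 (iterConst N CT Cfun pfun n).2 := by
  induction n with
  | zero => exact ⟨S, hL, fun k c _ _ => rfl, hG⟩
  | succ n ih =>
    obtain ⟨S₁, hL₁, hEq₁, hG₁⟩ := ih
    obtain ⟨S₂, hL₂, hEq₂, hG₂⟩ := hL₁.succ_uniform hT hΦ hgood hG₁
    refine ⟨S₂, hL₂, fun k c Z hZ => ?_, hG₂⟩
    rcases Nat.eq_zero_or_pos k with rfl | hk
    · rw [osBaseC_succ_zero, argRegion_empty] at hZ; exact absurd hZ (notMem_empty _)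
    · have hZ' : Z ∈ argRegion (osBaseC (N + n + 1) k) :=
        argRegion_mono (osBaseC_mono hk (show N + 1 ≤ N + n + 1 by omega)) hZ
      rw [hEq₂ k c hZ', hEq₁ k c hZ]

/-- **The analytic continuation of Osterwalder–Schrader II, Thm. 4.2, for every good label, with
explicit, label-uniform local bounds** (`k ≥ 1`): from labelled level data at `N` with growth
uniform over a class of labels closed under the doubling of the parts, the semigroup hypotheses and
the labelled real-point vectors, every `S k c` with `c` good extends to a function holomorphic on
the whole product of open right half-planes `ℂ₊ᵏ` (`⋃_N C_k^{(N)} = ℂ₊ᵏ`, Lemma 5.2), equal to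
`S k c` on the region of `c_k^{(N+1)}`, and bounded on the argument region of every compact part
`K` of the cube `(-π/2, π/2)ᵏ` by `cubeConst K · Π(Z)^{cubeExp K}`, functions of the input constants
and of `K` only. [cite: OsterwalderSchraderCMP1975, §IV.2 Thm. 4.2, Ch. V.2 Lemma 5.2, Ch. VI.2 (6.28)] -/
theorem IsOSLabelledLevel.exists_continuation_halfPlanes_uniform (hT : IsOSSemigroup T CT)
    (hΦ : IsOSLabelledVectors T Φ) (hgood : IsOSLabelSet good) (hL : IsOSLabelledLevel N good S Φ)
    (hG : IsOSLabelledGrowth N good S Cfun pfun) {k : ℕ} (hk : 0 < k) {c : Fin (k + 1) → E} (hc : good k c) :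
    ∃ Sext : (Fin k → ℂ) → ℂ,
      DifferentiableOn ℂ Sext {Z | ∀ i, 0 < (Z i).re} ∧
      EqOn Sext (S k c) (argRegion (osBaseC (N + 1) k)) ∧
      ∀ K : Set (Fin k → ℝ), IsCompact K → K ⊆ {v | ∀ i, |v i| < Real.pi / 2} →
        ∀ Z ∈ argRegion K, ‖Sext Z‖ ≤ cubeConst N CT Cfun pfun k K * gFactor Z ^ cubeExp N CT Cfun pfun k K := by
  classical
  choose Sn hSnL hSnEq hSnG using fun n => hL.exists_level_uniform hT hΦ hgood hG n
  -- the family of levels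
  set U : ℕ → Set (Fin k → ℂ) := fun n => argRegion (osBaseC (N + n + 1) k) with hU
  have hUo : ∀ n, IsOpen (U n) := fun n => isOpen_argRegion (isOpen_osBaseC_succ _ _)
  have hFd : ∀ n, DifferentiableOn ℂ (Sn n k c) (U n) := fun n => (hSnL n).holo k c hc
  have hagree : ∀ n m, EqOn (Sn n k c) (Sn m k c) (U n ∩ U m) := by
    intro n m
    simp only [hU]
    rw [← argRegion_inter]
    refine eqOn_argRegion_of_eqOn_posReal ((isOpen_osBaseC_succ _ _).inter (isOpen_osBaseC_succ _ _))
      ((isOSBaseFamily_osBase.convex _ _).inter (isOSBaseFamily_osBase.convex _ _))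
      ⟨zero_mem_osBaseC _ hk, zero_mem_osBaseC _ hk⟩ (fun v hv => osBaseC_subset_cube _ _ hv.1)
      ((hFd n).mono (argRegion_mono inter_subset_left))
      ((hFd m).mono (argRegion_mono inter_subset_right)) fun η hη => ?_
    have hmem : (fun i => (η i : ℂ)) ∈ argRegion (osBaseC (N + 1) k) :=
      ofReal_mem_argRegion (zero_mem_osBaseC _ hk) hη
    rw [hSnEq n k c hmem, hSnEq m k c hmem]
  obtain ⟨Gk, hGd, hGi⟩ := exists_differentiableOn_iUnion_of_eqOn_inter U (fun n => Sn n k c) hUo hFd hagree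
  obtain ⟨k', rfl⟩ : ∃ k', k = k' + 1 := ⟨k - 1, by omega⟩
  have hcube : ⋃ n, osBaseC (N + n + 1) (k' + 1) = {v | ∀ i, |v i| < Real.pi / 2} := by
    apply Subset.antisymm (iUnion_subset fun n => osBaseC_subset_cube _ _)
    rw [← iUnion_osBaseC k']
    refine iUnion_subset fun M => ?_
    exact (osBaseC_mono (Nat.succ_pos k') (show M ≤ N + M + 1 by omega)).trans
      (subset_iUnion (fun n => osBaseC (N + n + 1) (k' + 1)) M)
  have hUnion : (⋃ n, U n) = {Z : Fin (k' + 1) → ℂ | ∀ i, 0 < (Z i).re} := by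
    simp only [hU]
    rw [← argRegion_iUnion, hcube]
    ext Z
    simp only [mem_argRegion, mem_setOf_eq, and_iff_left_iff_imp]
    intro hZ i
    exact Complex.abs_arg_lt_pi_div_two_iff.2 (Or.inl (hZ i))
  refine ⟨Gk, by rw [← hUnion]; exact hGd, fun Z hZ => ?_, fun K hKc hKcube Z hZ => ?_⟩
  · have h0 : Z ∈ U 0 := hZ
    rw [hGi 0 h0]
    exact hSnEq 0 _ _ hZ
  · set n := cubeLevel N (k' + 1) K with hn
    have hKn : K ⊆ osBaseC (N + n + 1) (k' + 1) := subset_osBaseC_cubeLevel hKc hKcube hk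
    have hZU : Z ∈ U n := ⟨hZ.1, hKn hZ.2⟩
    rw [hGi n hZU]
    exact (hSnG n).bound (k' + 1) c hc K hKn hKc Z hZ

end Step

end Literature.MathematicalPhysics.QuantumFieldTheory.OSEnvelope
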